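import Literature.AlgebraicGeometry.Resolution.FiniteExtensionUniformizationProofs
import Literature.AlgebraicGeometry.Resolution.SmoothImpliesRegular
import HarnessLib

/-!
# Knaf–Kuhlmann 2009, Thm. 1.2 from its ingredients (assembly)

Topic: `Literature/AlgebraicGeometry/Resolution`. Third layer of the decomposition of the named
fact `KnafKuhlmann2009` (`LocalUniformization.lean`). We PROVE, from the named facts of
`FiniteExtensionUniformization.lean` (KK09 Thm. 1.1, Prop. 2.3, Prop. 3.2, Prop. 3.4 (2); KK05
Thm. 1.1, Cor. 2.2 — of which Prop. 3.2 (in a strong form), Prop. 3.4 (2) and KK05 Cor. 2.2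
are theorems, `FiniteExtensionUniformizationProofs.lean`) and the theorem "smooth over a field
⇒ regular" (`isRegularLocalRing_of_isSmoothAt`, `SmoothImpliesRegular.lean`, replacing the named
fact `Grothendieck1967_17_5_8` of `SmoothUniformization.lean` in the last step):

* `knafKuhlmann2009_thm12_of_perfect` — Thm. 1.2 over a PERFECT ground field `K ⊆ V` in the
  ambient rendering, with `𝒦 = K`: there is a finite separable `𝓕|F` such that `(V ∩ 𝓕, Z)` is
  smoothly `K`-uniformizable. This is §4.2 of the paper verbatim (Prop. 2.3 ⇒ Thm. 1.1 for
  `F|F₀` ⇒ Prop. 3.2 ⇒ KK05 Thm. 1.1 for `𝓕₀|K` ⇒ Prop. 3.2 again ⇒ compose), the residue field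
  extension `𝓕₀P|K` being separable because `K`, hence `KP`, is perfect.
* `knafKuhlmann2009_thm12_ambient` — Thm. 1.2 (first paragraph) in the ambient rendering for an
  arbitrary ground field `k ⊆ V`: run the previous result over the perfect hull `k^{1/p^∞}`
  (inside the algebraically closed `Ω`) and descend, by Prop. 3.4 (2) applied over `k(T')` for
  a finite set `T'` of constants making the generators of `𝓕` separable over `F(T')`, to a
  finitely generated, hence finite purely inseparable, `𝒦|k` with `𝓕|F.𝒦` separable. (The
  paper instead passes to a finite purely inseparable `𝒦` making `𝓕₀P.𝒦|𝒦`
  separable before applying KK05; the order used here — first `k^{1/p^∞}`, then descent to a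
  finitely generated constant subextension — is that of F.-V. Kuhlmann, *On local
  uniformization in arbitrary characteristic, I*, arXiv:math/9903097, Lemma 4.1 (b) and §7
  (p. 20), and avoids an unprinted finiteness lemma; the statement proved is the printed
  Thm. 1.2 of Knaf–Kuhlmann 2009.)
* `KnafKuhlmann2009_Thm12.of_parts` — the type-level named fact `KnafKuhlmann2009_Thm12` of
  `SmoothUniformization.lean` follows (transport from subfields of `Ω` to the types Mathlib's
  `IntermediateField`s provide).
* `KnafKuhlmann2009.of_thm12'`, `KnafKuhlmann2009.of_parts` — hence the named fact
  `KnafKuhlmann2009` (weak, regular-centre form), as in `KnafKuhlmann2009.of_thm12` but with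
  smooth ⇒ regular proved.

After this file the frontier of `KnafKuhlmann2009` (the hypotheses of
`KnafKuhlmann2009.of_parts`) consists of exactly the three Knaf–Kuhlmann facts KK09 Thm. 1.1,
KK09 Prop. 2.3 and KK05 Thm. 1.1. (Matsumura 19.4, used in `ValuedFunctionFieldsLemmas.lean` to
normalise the model of `𝓕₀|K`, is not needed: the strong form `knafKuhlmann2009_prop32_adjoin`
of Prop. 3.2 has no normality hypothesis; EGA IV 17.5.8 (iii) is replaced by its proved field
case.)

## Sources

* H. Knaf, F.-V. Kuhlmann, *Every place admits local uniformization in a finite extension of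
  the function field*, Adv. Math. 221 (2009) 428–453 = arXiv:math/0702856, §4.2 (proof of
  Thm. 1.2; pp. 24–25 in the printed pagination of arXiv v1).
* F.-V. Kuhlmann, *On local uniformization in arbitrary characteristic, I*, preprint (1999),
  arXiv:math/9903097 [Kuhlmann1999]: Lemma 4.1 (b) (p. 12: uniformizability of `F.L'|L'`
  descends to `F.L₀|L₀` for a finitely generated subextension `L₀|K` of `L'|K`) and §7 (p. 20:
  the proofs of the main theorems pass to the perfect hull `K^{1/p^∞}` and descend by
  Lemma 4.1 (b)).
-/

noncomputable section

namespace Literature.AlgebraicGeometry.Resolution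

universe u

open IsLocalRing

variable {Ω : Type u} [Field Ω]

/-! ## Improving a model over a field to an everywhere smooth one -/

/-- From a model `B ⊆ V ∩ E` over the subfield `K`, smooth over `K` at the centre and with
`Z₁ ⊆ B_q`, pass to `B₂ := B[1/f][1/d] ⊆ V ∩ E`: finitely generated, formally smooth over `K`
everywhere, containing `Z₁`, with the same fraction field (the normality-free part of
`exists_normal_smooth_model` of `ValuedFunctionFieldsLemmas.lean`, which is all the strong form
of Prop. 3.2 needs). [folklore] -/
theorem exists_smooth_model {K : Subfield Ω} {V : ValuationSubring Ω} {E : Subfield Ω}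
    {Z₁ : Finset Ω} (h : IsSmoothlyUniformizableIn K V E (Z₁ : Set Ω)) :
    ∃ (B₂ : Subalgebra K Ω), B₂.toSubring ≤ V.toSubring ∧ (B₂ : Set Ω) ⊆ E ∧ B₂.FG ∧
      Algebra.FormallySmooth K B₂ ∧ (Z₁ : Set Ω) ⊆ B₂ ∧
      ∀ x ∈ E, ∃ a ∈ B₂, ∃ b ∈ B₂, x = a / b := by
  classical
  obtain ⟨B, hBV, hBE, hfp, hfrac, hsm, hZ⟩ := h
  haveI := hfp
  haveI : Algebra.IsSmoothAt K (centre B V hBV) := hsm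
  -- Step 1: `B₁ := B[1/f]` smooth everywhere
  obtain ⟨f, hfq, hfsm⟩ := Algebra.IsSmoothAt.exists_notMem_smooth K (centre B V hBV)
  have hvf : V.valuation (f : Ω) = 1 := by
    have h1 : V.valuation (f : Ω) ≤ 1 := (V.valuation_le_one_iff _).mpr (hBV f.2)
    have h2 : ¬ V.valuation (f : Ω) < 1 := fun hlt => hfq ((mem_centre_iff B V hBV f).mpr hlt)
    exact le_antisymm h1 (not_lt.mp h2)
  have hf0 : (f : Ω) ≠ 0 := fun h0 => by simp [h0] at hvf
  let B₁ := locAway B (f : Ω) f.2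
  have hsm₁ : Algebra.Smooth K B₁ := smooth_locAway hf0 (by simpa using hfsm)
  haveI : Algebra.FormallySmooth K B₁ := hsm₁.1
  have hB₁V : B₁.toSubring ≤ V.toSubring := locAway_le_valuationSubring hBV hvf
  have hB₁E : (B₁ : Set Ω) ⊆ E := locAway_subset_subfield hBE hf0
  have hBfg : B.FG := (Subalgebra.fg_iff_finiteType B).mpr inferInstance
  have hB₁fg : B₁.FG := fg_locAway hf0 hBfg
  -- Step 2: `B₂ := B₁[1/d]`, `d` the product of the denominators of `Z₁`
  choose a ha b hb hvb hab using hZ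
  let d : Ω := ∏ w ∈ Z₁.attach, b w.1 w.2
  have hdB : d ∈ B := prod_mem fun w _ => hb w.1 w.2
  have hvd : V.valuation d = 1 := by
    change V.valuation (∏ w ∈ Z₁.attach, b w.1 w.2) = 1
    rw [map_prod]
    exact Finset.prod_eq_one fun w _ => hvb w.1 w.2
  have hd0 : d ≠ 0 := fun h0 => by simp [h0] at hvd
  let B₂ := locAway B₁ d (le_locAway hdB)
  haveI : Algebra.FormallySmooth K B₂ := formallySmooth_locAway hd0
  have hB₂V : B₂.toSubring ≤ V.toSubring := locAway_le_valuationSubring hB₁V hvd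
  have hB₂E : (B₂ : Set Ω) ⊆ E := locAway_subset_subfield hB₁E hd0
  have hB₂fg : B₂.FG := fg_locAway hd0 hB₁fg
  refine ⟨B₂, hB₂V, hB₂E, hB₂fg, inferInstance, ?_, ?_⟩
  · intro w hw
    refine ⟨1, ?_⟩
    rw [pow_one]
    have hb0 : b w hw ≠ 0 := fun h0 => by simpa [h0] using hvb w hw
    have hwb : w * b w hw = a w hw := by
      have h := hab w hw
      calc w * b w hw = a w hw / b w hw * b w hw := by rw [← h]
        _ = a w hw := div_mul_cancel₀ _ hb0
    have hprod := Finset.mul_prod_erase Z₁.attach (fun w' => b w'.1 w'.2)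
      (Finset.mem_attach _ ⟨w, hw⟩)
    have hd : d = b w hw * ∏ w' ∈ Z₁.attach.erase ⟨w, hw⟩, b w'.1 w'.2 := hprod.symm
    rw [hd, ← mul_assoc, hwb]
    exact le_locAway (mul_mem (ha w hw) (prod_mem fun w' _ => hb w'.1 w'.2))
  · intro x hx
    obtain ⟨a', ha', b', hb', rfl⟩ := hfrac x hx
    exact ⟨a', le_locAway (le_locAway ha'), b', le_locAway (le_locAway hb'), rfl⟩

/-! ## Thm. 1.2 over a perfect ground field -/

/-- **Knaf–Kuhlmann 2009, Thm. 1.2 over a perfect ground field** (ambient form, §4.2 of the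
paper): for a perfect subfield `K ⊆ V` of the algebraically closed valued field `(Ω, V)`, a
finitely generated `F ⊇ K` and a finite `Z ⊆ V ∩ F`, there is a finite separable extension
`𝓕|F` inside `Ω` such that `(V ∩ 𝓕, Z)` is smoothly `K`-uniformizable. [cite: KnafKuhlmann2009,
Thm. 1.2 and Section 4.2] -/
theorem knafKuhlmann2009_thm12_of_perfect (h11 : KnafKuhlmann2009_Thm11.{u})
    (h23 : KnafKuhlmann2009_Prop23.{u}) (h05 : KnafKuhlmann2005_Thm11.{u})
    (h22 : KnafKuhlmann2005_Cor22.{u})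
    [IsAlgClosed Ω] (V : ValuationSubring Ω) (K F : Subfield Ω) [PerfectField K]
    (hKF : K ≤ F) (hfg : FGOver K F) (hKV : (K : Set Ω) ⊆ V)
    (Z : Finset Ω) (hZ : ∀ z ∈ Z, z ∈ V ∧ z ∈ F) :
    ∃ 𝓕 : Subfield Ω, F ≤ 𝓕 ∧ FiniteSeparableOver F 𝓕 ∧ IsSmoothlyUniformizableIn K V 𝓕 Z := by
  classical
  -- Prop. 2.3: the Abhyankar subfunction field `F₀ = K(x, y)`
  have hsepKF : SeparablyGeneratedOver K F := separablyGeneratedOver_of_perfectField hfg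
  obtain ⟨ρ, τ, x, y, t, hy, hxF, hyF, htF, hind, hsep, hvi, hvs, hri, hrs⟩ :=
    h23 Ω V K F hKF hfg hsepKF
  set F₀ : Subfield Ω := Subfield.closure ((K : Set Ω) ∪ (Set.range x ∪ Set.range y)) with hF₀def
  have hKF₀ : K ≤ F₀ := fun z hz => Subfield.subset_closure (Or.inl hz)
  have hF₀F : F₀ ≤ F := by
    refine Subfield.closure_le.mpr (Set.union_subset hKF (Set.union_subset ?_ ?_))
    · rintro _ ⟨i, rfl⟩; exact hxF i
    · rintro _ ⟨j, rfl⟩; exact hyF j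
  have hfg₀ : FGOver F₀ F := hfg.mono_left hKF₀ hF₀F
  have hsep₀ : SeparablyGeneratedOver F₀ F := separablyGeneratedOver_closure htF hind hsep
  have htor₀ : IsValueTorsionOver V F₀ F := isValueTorsionOver_closure hvs
  have hres₀ : IsResiduallyAlgebraicOver V F₀ F := isResiduallyAlgebraicOver_closure hy hrs
  -- Thm. 1.1 for `(F | F₀, V)`
  obtain ⟨𝓕, 𝓕₀, hF𝓕, hF₀𝓕₀, h𝓕₀𝓕, hfinsep, hfin₀, A, hAV, hA𝓕, hfpA, hfracA, hsmA, hfact⟩ :=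
    h11 Ω V F₀ F hF₀F hfg₀ hsep₀ htor₀ hres₀ Z hZ
  -- `𝓕₀ | K` is an Abhyankar function field with separably generated residue field extension
  have hK𝓕₀ : K ≤ 𝓕₀ := hKF₀.trans hF₀𝓕₀
  have hfgK𝓕₀ : FGOver K 𝓕₀ := (fgOver_closure_range K x y).trans hfin₀.fgOver
  have hAbh : IsAbhyankarPlace V K 𝓕₀ :=
    isAbhyankarPlace_of_algebraic hy hvi hri hF₀𝓕₀ fun z hz => hfin₀.isAlgebraic hz
  obtain ⟨-, hresfg⟩ := h22 Ω V K 𝓕₀ hK𝓕₀ hfgK𝓕₀ hAbh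
  haveI : PerfectField (resField V K) := perfectField_resField hKV
  have hressep : SeparablyGeneratedOver (resField V K) (resField V 𝓕₀) :=
    separablyGeneratedOver_of_perfectField hresfg
  -- Prop. 3.2 for `A` over `S := V ∩ 𝓕₀`, with `R := K` and the finite set `U` of units
  haveI : IsIntegrallyClosed ↥(V.toSubring ⊓ 𝓕₀.toSubring) := isIntegrallyClosed_inf V 𝓕₀
  have hSinj : Function.Injective (algebraMap ↥(V.toSubring ⊓ 𝓕₀.toSubring) Ω) :=
    Subtype.coe_injective
  have hrangeS : Set.range (algebraMap ↥(V.toSubring ⊓ 𝓕₀.toSubring) Ω) =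
      ((V.toSubring ⊓ 𝓕₀.toSubring : Subring Ω) : Set Ω) := Subtype.range_coe
  choose a ha b hb z' hz'𝓕₀ hz'V hva hvb hzab using hfact
  let U : Finset Ω := Z.attach.image fun z => a z.1 z.2 / b z.1 z.2
  have hU : ∀ u ∈ U, ∃ a ∈ A, ∃ b ∈ A, V.valuation b = 1 ∧ u = a / b := by
    intro u hu
    obtain ⟨z, -, rfl⟩ := Finset.mem_image.mp hu
    exact ⟨a z.1 z.2, ha z.1 z.2, b z.1 z.2, hb z.1 z.2, hvb z.1 z.2, rfl⟩
  haveI := hfpA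
  obtain ⟨S₀, G, hS₀S, -, hdesc⟩ :=
    knafKuhlmann2009_prop32_adjoin V ↥(V.toSubring ⊓ 𝓕₀.toSubring) hSinj A hAV hsmA U hU
  -- KK05 Thm. 1.1 for `(𝓕₀ | K, V)` with `Z' ∪ S₀`
  let Z' : Finset Ω := Z.attach.image fun z => z' z.1 z.2
  have hZ'S₀ : ∀ w ∈ Z' ∪ S₀, w ∈ V ∧ w ∈ 𝓕₀ := by
    intro w hw
    rcases Finset.mem_union.mp hw with hw | hw
    · obtain ⟨z, -, rfl⟩ := Finset.mem_image.mp hw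
      exact ⟨hz'V z.1 z.2, hz'𝓕₀ z.1 z.2⟩
    · have hw' : w ∈ Set.range (algebraMap ↥(V.toSubring ⊓ 𝓕₀.toSubring) Ω) :=
        hS₀S (Finset.mem_coe.mpr hw)
      rw [hrangeS] at hw'
      exact hw'
  have hB := h05 Ω V K 𝓕₀ hK𝓕₀ hfgK𝓕₀ hKV hAbh hressep (Z' ∪ S₀) hZ'S₀
  -- an everywhere smooth model `B₂ ⊇ Z' ∪ S₀` of `𝓕₀ | K`
  obtain ⟨B₂, hB₂V, hB₂𝓕₀, hB₂fg, hB₂sm, hZ'S₀B₂, hfracB₂⟩ := exists_smooth_model hB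
  haveI := hB₂sm
  haveI : Algebra.FiniteType K B₂ := (Subalgebra.fg_iff_finiteType B₂).mp hB₂fg
  -- Prop. 3.2 (strong form), conclusion for `S' := B₂` with `S₀ ⊆ B₂ ⊆ V ∩ 𝓕₀`
  have hB₂inj : Function.Injective (algebraMap B₂ Ω) := Subtype.coe_injective
  have hrangeB₂ : Set.range (algebraMap B₂ Ω) = (B₂ : Set Ω) := Subtype.range_coe
  have h2 : (S₀ : Set Ω) ⊆ Set.range (algebraMap B₂ Ω) := by
    rw [hrangeB₂]
    intro w hw
    exact hZ'S₀B₂ (Finset.mem_coe.mpr (Finset.mem_union_right _ (Finset.mem_coe.mp hw)))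
  have h3 : Set.range (algebraMap B₂ Ω) ⊆
      Set.range (algebraMap ↥(V.toSubring ⊓ 𝓕₀.toSubring) Ω) := by
    rw [hrangeB₂, hrangeS]
    exact fun w hw => ⟨hB₂V hw, hB₂𝓕₀ hw⟩
  obtain ⟨C, hCV, -, hCA, hfpC, hsmC, hUC, hclos⟩ := hdesc B₂ hB₂inj h2 h3
  -- the model `C`, viewed over `K`
  have hC𝓕 : (C : Set Ω) ⊆ 𝓕 := by
    intro w hw
    obtain ⟨a', ha', b', hb', -, rfl⟩ := hCA w hw
    exact div_mem (hA𝓕 ha') (hA𝓕 hb')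
  have hB₂C : (B₂ : Set Ω) ⊆ C := fun w hw => C.algebraMap_mem (⟨w, hw⟩ : B₂)
  have hclosC : Subfield.closure (C : Set Ω) = 𝓕 := by
    have hA : Subfield.closure (A : Set Ω) = 𝓕 := subfield_closure_eq_of_frac hA𝓕 hfracA
    rw [← hA, ← hclos]
    refine le_antisymm (Subfield.closure_mono Set.subset_union_left) (Subfield.closure_le.mpr ?_)
    refine Set.union_subset Subfield.subset_closure ?_
    rw [hrangeS]
    rintro w ⟨-, hw𝓕₀⟩
    obtain ⟨a', ha', b', hb', rfl⟩ := hfracB₂ w hw𝓕₀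
    exact div_mem (Subfield.subset_closure (hB₂C ha')) (Subfield.subset_closure (hB₂C hb'))
  refine ⟨𝓕, hF𝓕, hfinsep, ?_⟩
  refine isSmoothlyUniformizableIn_of_tower (R := K) B₂ C hCV hC𝓕 hfpC hsmC ?_ ?_
  · intro w hw
    rw [← hclosC] at hw
    exact exists_div_of_mem_closure C.toSubring hw
  · intro z hz
    have hz' : z ∈ Z := Finset.mem_coe.mp hz
    have hu : a z hz' / b z hz' ∈ U := Finset.mem_image.mpr ⟨⟨z, hz'⟩, Finset.mem_attach _ _, rfl⟩
    obtain ⟨a', ha', b', hb', hvb', hu'⟩ := hUC _ hu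
    have hz'C : z' z hz' ∈ C :=
      hB₂C (hZ'S₀B₂ (Finset.mem_coe.mpr (Finset.mem_union_left _
        (Finset.mem_image.mpr ⟨⟨z, hz'⟩, Finset.mem_attach _ _, rfl⟩))))
    refine ⟨a' * z' z hz', mul_mem ha' hz'C, b', hb', hvb', ?_⟩
    calc z = a z hz' / b z hz' * z' z hz' := hzab z hz'
      _ = a' / b' * z' z hz' := by rw [hu']
      _ = a' * z' z hz' / b' := div_mul_eq_mul_div _ _ _

/-! ## Thm. 1.2 (first paragraph) for an arbitrary ground field -/

/-- **Knaf–Kuhlmann 2009, Thm. 1.2 (first paragraph), ambient form**: for a subfield `k ⊆ V`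
of the algebraically closed valued field `(Ω, V)`, a finitely generated `F ⊇ k` and a finite
`Z ⊆ V ∩ F`, there are a finite purely inseparable `𝒦|k` and a finite separable `𝓕|F.𝒦`
inside `Ω` such that `(V ∩ 𝓕, Z)` is smoothly `𝒦`-uniformizable. Proof: Thm. 1.2 over the
perfect hull `k^{1/p^∞}` (`knafKuhlmann2009_thm12_of_perfect`), then finite descent
(Prop. 3.4 (2)) over `k(T')`, `T' ⊆ k^{1/p^∞}` a finite set of constants making the generators
of `𝓕` separable over `F(T')`. [cite: KnafKuhlmann2009, Thm. 1.2] -/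
theorem knafKuhlmann2009_thm12_ambient (h11 : KnafKuhlmann2009_Thm11.{u})
    (h23 : KnafKuhlmann2009_Prop23.{u}) (h342 : KnafKuhlmann2009_Prop34_2.{u})
    (h05 : KnafKuhlmann2005_Thm11.{u}) (h22 : KnafKuhlmann2005_Cor22.{u})
    [IsAlgClosed Ω] (V : ValuationSubring Ω) (k F : Subfield Ω)
    (hkF : k ≤ F) (hfg : FGOver k F) (hkV : (k : Set Ω) ⊆ V)
    (Z : Finset Ω) (hZ : ∀ z ∈ Z, z ∈ V ∧ z ∈ F) :
    ∃ (𝒦 𝓕 : Subfield Ω), k ≤ 𝒦 ∧ F ≤ 𝓕 ∧ 𝒦 ≤ 𝓕 ∧ FinitePurelyInseparableOver k 𝒦 ∧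
      FiniteSeparableOver (F ⊔ 𝒦) 𝓕 ∧ IsSmoothlyUniformizableIn 𝒦 V 𝓕 Z := by
  classical
  -- Step 1: Thm. 1.2 over the perfect hull `K := k^{1/p^∞}` for `F∞ := F.K`
  let K : Subfield Ω := perfectHull k
  have hkK : k ≤ K := le_perfectHull k
  have hKV : (K : Set Ω) ⊆ V := perfectHull_subset_valuationSubring k hkV
  have hKalg : ∀ x ∈ K, IsAlgebraic k x := fun x hx => isAlgebraic_of_mem_perfectHull k hx
  have hfgK : FGOver K (F ⊔ K) := hfg.sup_right hkK
  have hZK : ∀ z ∈ Z, z ∈ V ∧ z ∈ F ⊔ K := fun z hz =>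
    ⟨(hZ z hz).1, (le_sup_left : F ≤ F ⊔ K) (hZ z hz).2⟩
  obtain ⟨𝓕K, hF𝓕K, hfinsepK, hSUK⟩ := knafKuhlmann2009_thm12_of_perfect h11 h23 h05 h22
    V K (F ⊔ K) le_sup_right hfgK hKV Z hZK
  -- Step 2: generators; the finitely generated subfield `F' = k(Z, G) ⊇ F` with `F'.K = 𝓕K`
  obtain ⟨s, hs⟩ := hfg
  have hsF : ∀ x ∈ s, x ∈ F := fun x hx => hs ▸ Subfield.subset_closure (Or.inr hx)
  have hs𝓕K : (s : Set Ω) ⊆ 𝓕K := fun x hx => hF𝓕K ((le_sup_left : F ≤ F ⊔ K) (hsF x hx))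
  obtain ⟨G, hG𝓕K, hGV, hSUG, hclosG, hsG⟩ := hSUK.exists_gens s hs𝓕K
  let F' : Subfield Ω := Subfield.closure ((k : Set Ω) ∪ ((Z ∪ G : Finset Ω) : Set Ω))
  have hkF' : k ≤ F' := fun c hc => Subfield.subset_closure (Or.inl hc)
  have hZGF' : ((Z ∪ G : Finset Ω) : Set Ω) ⊆ F' := fun w hw => Subfield.subset_closure (Or.inr hw)
  have hFF' : F ≤ F' := by
    rw [← hs]
    refine Subfield.closure_le.mpr (Set.union_subset hkF' fun w hw => ?_)
    obtain ⟨a, ha, b, hb, rfl⟩ := hsG w hw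
    exact div_mem (hZGF' (by simp [ha])) (hZGF' (by simp [hb]))
  have hF'𝓕K : F' ≤ 𝓕K := by
    refine Subfield.closure_le.mpr (Set.union_subset ?_ ?_)
    · exact fun c hc => hF𝓕K ((le_sup_right : K ≤ F ⊔ K) (hkK hc))
    · intro w hw
      rw [Finset.coe_union] at hw
      rcases hw with hw | hw
      · exact hF𝓕K ((le_sup_left : F ≤ F ⊔ K) (hZ w hw).2)
      · exact hG𝓕K hw
  have hF'K : F' ⊔ K = 𝓕K := by
    refine le_antisymm (sup_le hF'𝓕K ((le_sup_right : K ≤ F ⊔ K).trans hF𝓕K)) ?_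
    rw [← hclosG]
    refine Subfield.closure_le.mpr (Set.union_subset ?_ ?_)
    · exact fun c hc => (le_sup_right : K ≤ F' ⊔ K) hc
    · intro w hw
      exact (le_sup_left : F' ≤ F' ⊔ K) (hZGF' (by simp [Finset.mem_coe.mp hw]))
  -- Step 3: a finite set `T' ⊆ K` of constants making the generators separable over `F(T')`
  have hFK : Subfield.closure ((F : Set Ω) ∪ K) = F ⊔ K := by
    rw [closure_union_eq_sup, Subfield.closure_eq]
  have hgen : ∀ g ∈ Z ∪ G, ∃ T : Finset Ω, (T : Set Ω) ⊆ K ∧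
      IsSeparable (IntermediateField.adjoin F (T : Set Ω)) g := by
    intro g hg
    have hg𝓕K : g ∈ 𝓕K := hF'𝓕K (hZGF' (Finset.mem_coe.mpr hg))
    have h1 : IsSeparable ↥(F ⊔ K) g := hfinsepK.isSeparable hg𝓕K
    have h2 : IsSeparable (IntermediateField.adjoin F (K : Set Ω)) g :=
      (isSeparable_closure_iff F (K : Set Ω) g).mp (isSeparable_of_subfield_le hFK.symm.le h1)
    exact exists_finset_isSeparable_of_isSeparable_adjoin h2
  choose T hTK hTsep using hgen
  let T' : Finset Ω := (Z ∪ G).attach.biUnion fun g => T g.1 g.2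
  have hT'K : (T' : Set Ω) ⊆ K := by
    intro w hw
    obtain ⟨g, -, hwg⟩ := Finset.mem_biUnion.mp (Finset.mem_coe.mp hw)
    exact hTK g.1 g.2 (Finset.mem_coe.mpr hwg)
  -- Step 4: finite descent of the constants from `K` to a finitely generated `M ⊇ k(T')`
  -- (Prop. 3.4 (2), applied over the ground field `k' := k(T')`)
  let k' : Subfield Ω := Subfield.closure ((k : Set Ω) ∪ (T' : Set Ω))
  have hkk' : k ≤ k' := fun c hc => Subfield.subset_closure (Or.inl hc)
  have hT'k' : (T' : Set Ω) ⊆ k' := fun w hw => Subfield.subset_closure (Or.inr hw)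
  have hk'K : k' ≤ K := Subfield.closure_le.mpr (Set.union_subset hkK hT'K)
  have hKalg' : ∀ x ∈ K, IsAlgebraic k' x := fun x hx =>
    isAlgebraic_of_subfield_le hkk' (hKalg x hx)
  have hsup₁ : F' ⊔ k' ⊔ K = 𝓕K := by rw [sup_assoc, sup_eq_right.mpr hk'K, hF'K]
  have hclos' : Subfield.closure ((k' : Set Ω) ∪ ((Z ∪ G : Finset Ω) : Set Ω)) = F' ⊔ k' := by
    refine le_antisymm (Subfield.closure_le.mpr (Set.union_subset ?_ ?_)) (sup_le ?_ ?_)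
    · exact fun c hc => (le_sup_right : k' ≤ F' ⊔ k') hc
    · exact fun w hw => (le_sup_left : F' ≤ F' ⊔ k') (hZGF' hw)
    · exact Subfield.closure_mono (Set.union_subset_union_left _ fun c hc => hkk' hc)
    · exact fun c hc => Subfield.subset_closure (Or.inl hc)
  have hSUinf : IsSmoothlyUniformizableIn ↥(V.toSubring ⊓ K.toSubring) V (F' ⊔ k' ⊔ K)
      ((Z ∪ G : Finset Ω) : Set Ω) := by
    rw [hsup₁, Finset.coe_union]
    exact (isSmoothlyUniformizableIn_inf_iff V K hKV _ _).mpr hSUG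
  have hZGVF' : ∀ z ∈ Z ∪ G, z ∈ V ∧ z ∈ F' ⊔ k' := fun z hz =>
    ⟨(Finset.mem_union.mp hz).elim (fun h => (hZ z h).1) (fun h => hGV (Finset.mem_coe.mpr h)),
      (le_sup_left : F' ≤ F' ⊔ k') (hZGF' (Finset.mem_coe.mpr hz))⟩
  obtain ⟨M, hk'M, hMK, hfgM, hSUM⟩ := h342 Ω V k' (F' ⊔ k') K le_sup_right hk'K hKalg'
    (Z ∪ G) hZGVF' ⟨Z ∪ G, subset_rfl, hclos'⟩ hSUinf
  -- Step 5: `𝒦 := M`, `𝓕 := F'.M`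
  have hkM : k ≤ M := hkk'.trans hk'M
  have hMV : (M : Set Ω) ⊆ V := fun w hw => hKV (hMK hw)
  have hfgkM : FGOver k M := (fgOver_closure k T').trans hfgM
  have hfpi : FinitePurelyInseparableOver k M := finitePurelyInseparableOver_of_le_perfectHull k hfgkM hMK
  have hsup₂ : F' ⊔ k' ⊔ M = F' ⊔ M := by rw [sup_assoc, sup_eq_right.mpr hk'M]
  rw [hsup₂] at hSUM
  refine ⟨M, F' ⊔ M, hkM, hFF'.trans le_sup_left, le_sup_right, hfpi, ?_, ?_⟩
  · -- `F'.M | F.M` is finite separable, generated by `Z ∪ G`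
    refine ⟨Z ∪ G, fun g hg => ?_, ?_⟩
    · have h1 : IsSeparable (Subfield.closure ((F : Set Ω) ∪ (T g hg : Set Ω))) g :=
        (isSeparable_closure_iff F _ g).mpr (hTsep g hg)
      refine isSeparable_of_subfield_le (Subfield.closure_le.mpr (Set.union_subset ?_ ?_)) h1
      · exact fun w hw => (le_sup_left : F ≤ F ⊔ M) hw
      · intro w hw
        refine (le_sup_right : M ≤ F ⊔ M) (hk'M (hT'k' ?_))
        exact Finset.mem_coe.mpr (Finset.mem_biUnion.mpr ⟨⟨g, hg⟩, Finset.mem_attach _ _,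
          Finset.mem_coe.mp hw⟩)
    · refine le_antisymm (Subfield.closure_le.mpr (Set.union_subset ?_ ?_)) (sup_le ?_ ?_)
      · intro w hw
        exact (sup_le (hFF'.trans le_sup_left) le_sup_right : F ⊔ M ≤ F' ⊔ M) hw
      · exact fun w hw => (le_sup_left : F' ≤ F' ⊔ M) (hZGF' hw)
      · refine Subfield.closure_mono (Set.union_subset_union_left _ fun c hc => ?_)
        exact (le_sup_left : F ≤ F ⊔ M) (hkF hc)
      · exact fun c hc => Subfield.subset_closure (Or.inl ((le_sup_right : M ≤ F ⊔ M) hc))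
  · have := (isSmoothlyUniformizableIn_inf_iff V M hMV _ _).mp hSUM
    refine this.mono ?_
    rw [Finset.coe_union]
    exact Set.subset_union_left

/-! ## From subfields of `Ω` to Mathlib's intermediate fields: transport lemmas -/

/-- Pulling back a valuation subring along a field homomorphism preserves "`v < 1`".
[folklore] -/
theorem comap_valuation_lt_one_iff {K L : Type*} [Field K] [Field L] (O : ValuationSubring L)
    (f : K →+* L) (x : K) :
    (O.comap f).valuation x < 1 ↔ O.valuation (f x) < 1 := by
  rw [← ValuationSubring.mem_nonunits_iff, ← ValuationSubring.mem_nonunits_iff,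
    ValuationSubring.mem_nonunits_iff_or, ValuationSubring.mem_nonunits_iff_or,
    ValuationSubring.mem_comap, map_inv₀, map_eq_zero_iff f f.injective]

/-- Pulling back a valuation subring along a field homomorphism preserves "`v = 1`" on its
elements. [folklore] -/
theorem comap_valuation_eq_one_iff {K L : Type*} [Field K] [Field L] (O : ValuationSubring L)
    (f : K →+* L) {x : K} (hx : x ∈ O.comap f) :
    (O.comap f).valuation x = 1 ↔ O.valuation (f x) = 1 := by
  have h1 : (O.comap f).valuation x ≤ 1 := ((O.comap f).valuation_le_one_iff x).mpr hx
  have h2 : O.valuation (f x) ≤ 1 :=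
    (O.valuation_le_one_iff _).mpr (ValuationSubring.mem_comap.mp hx)
  have h := comap_valuation_lt_one_iff O f x
  constructor
  · intro he
    by_contra hne
    have := h.mpr (lt_of_le_of_ne h2 hne)
    rw [he] at this
    exact lt_irrefl _ this
  · intro he
    by_contra hne
    have := h.mp (lt_of_le_of_ne h1 hne)
    rw [he] at this
    exact lt_irrefl _ this

/-- Finite presentation is transported along a compatible pair of ring isomorphisms of the
base rings and of the algebras. [folklore] -/
theorem finitePresentation_of_ringEquiv_pair {R R' A A' : Type*} [CommRing R] [CommRing R']
    [CommRing A] [CommRing A'] [Algebra R A] [Algebra R' A'] (eR : R ≃+* R') (eA : A ≃+* A')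
    (h : ∀ r, eA (algebraMap R A r) = algebraMap R' A' (eR r))
    [Algebra.FinitePresentation R A] : Algebra.FinitePresentation R' A' := by
  letI : Algebra R' R := eR.symm.toRingHom.toAlgebra
  letI : Algebra R' A := ((algebraMap R A).comp eR.symm.toRingHom).toAlgebra
  haveI : IsScalarTower R' R A := IsScalarTower.of_algebraMap_eq fun _ => rfl
  let e₁ : R' ≃ₐ[R'] R := { eR.symm with commutes' := fun _ => rfl }
  haveI : Algebra.FinitePresentation R' R := Algebra.FinitePresentation.equiv e₁
  haveI : Algebra.FinitePresentation R' A := Algebra.FinitePresentation.trans R' R A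
  let e₂ : A ≃ₐ[R'] A' :=
    { eA with
      commutes' := fun r => by
        change eA (algebraMap R A (eR.symm r)) = algebraMap R' A' r
        rw [h, eR.apply_symm_apply] }
  exact Algebra.FinitePresentation.equiv e₂

/-- Formal smoothness of local rings is transported along a compatible pair of ring
isomorphisms of the base rings and of the algebras, for corresponding primes. [folklore] -/
theorem formallySmooth_localization_of_ringEquiv_pair {R R' A A' : Type*} [CommRing R]
    [CommRing R'] [CommRing A] [CommRing A'] [Algebra R A] [Algebra R' A'] (eR : R ≃+* R')
    (eA : A ≃+* A') (h : ∀ r, eA (algebraMap R A r) = algebraMap R' A' (eR r))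
    (q : Ideal A) (q' : Ideal A') [q.IsPrime] [q'.IsPrime] (hq : ∀ x, x ∈ q ↔ eA x ∈ q')
    (hs : Algebra.FormallySmooth R (Localization.AtPrime q)) :
    Algebra.FormallySmooth R' (Localization.AtPrime q') := by
  let X := Localization.AtPrime q
  let X' := Localization.AtPrime q'
  letI : Algebra R' R := eR.symm.toRingHom.toAlgebra
  letI algX : Algebra R' X := ((algebraMap R X).comp eR.symm.toRingHom).toAlgebra
  haveI : IsScalarTower R' R X := IsScalarTower.of_algebraMap_eq fun _ => rfl
  let e₁ : R' ≃ₐ[R'] R := { eR.symm with commutes' := fun _ => rfl }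
  haveI : Algebra.FormallySmooth R' R := Algebra.FormallySmooth.of_equiv e₁
  haveI : Algebra.FormallySmooth R X := hs
  haveI hX : Algebra.FormallySmooth R' X := Algebra.FormallySmooth.comp R' R X
  have hcompl : q.primeCompl.map eA.toMonoidHom = q'.primeCompl := by
    ext x
    simp only [Submonoid.mem_map, Ideal.mem_primeCompl_iff]
    constructor
    · rintro ⟨y, hy, rfl⟩
      exact fun h' => hy ((hq y).mpr h')
    · intro hx
      refine ⟨eA.symm x, fun h' => hx ?_, eA.apply_symm_apply x⟩
      have := (hq _).mp h'
      rwa [eA.apply_symm_apply] at this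
  let eX : X ≃+* X' :=
    IsLocalization.ringEquivOfRingEquiv (M := q.primeCompl) (T := q'.primeCompl) X X' eA hcompl
  have hcomm : ∀ r : R', eX (algebraMap R' X r) = algebraMap R' X' r := by
    intro r
    have h1 : algebraMap R' X r = algebraMap A X (algebraMap R A (eR.symm r)) := by
      change algebraMap R X (eR.symm r) = _
      exact IsScalarTower.algebraMap_apply R A X _
    have h2 : algebraMap R' X' r = algebraMap A' X' (algebraMap R' A' r) :=
      IsScalarTower.algebraMap_apply R' A' X' r
    rw [h1, h2]
    change IsLocalization.ringEquivOfRingEquiv (M := q.primeCompl) (T := q'.primeCompl) X X' eA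
      hcompl _ = _
    rw [IsLocalization.ringEquivOfRingEquiv_eq]
    congr 1
    rw [h, eR.apply_symm_apply]
  exact Algebra.FormallySmooth.of_equiv (AlgEquiv.ofRingEquiv (f := eX) hcomm)

/-! ## The type-level Thm. 1.2 and the fact `KnafKuhlmann2009` -/

/-- **Knaf–Kuhlmann 2009, Thm. 1.2 (first paragraph) from its ingredients**: the named fact
`KnafKuhlmann2009_Thm12` of `SmoothUniformization.lean` follows from KK09 Thm. 1.1,
Prop. 2.3 and KK05 Thm. 1.1 (and the theorems KK09 Prop. 3.2, Prop. 3.4 (2), KK05 Cor. 2.2),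
by transport of `knafKuhlmann2009_thm12_ambient` to Mathlib's intermediate fields.
[cite: KnafKuhlmann2009, Thm. 1.2] -/
theorem KnafKuhlmann2009_Thm12.of_parts (h11 : KnafKuhlmann2009_Thm11.{u})
    (h23 : KnafKuhlmann2009_Prop23.{u}) (h05 : KnafKuhlmann2005_Thm11.{u}) :
    KnafKuhlmann2009_Thm12.{u} := by
  have h342 : KnafKuhlmann2009_Prop34_2.{u} := KnafKuhlmann2009_Prop34_2_holds
  have h22 : KnafKuhlmann2005_Cor22.{u} := KnafKuhlmann2005_Cor22_holds
  intro k F _ _ _ hfgtop O hkO Z hZO Ω _ _ _ _ _ V hVO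
  classical
  haveI : IsAlgClosed Ω := IsAlgClosure.isAlgClosed F
  -- the subfields `k̂ ≤ F̂` of `Ω`
  let kh : Subfield Ω := (algebraMap k Ω).fieldRange
  let Fh : Subfield Ω := (algebraMap F Ω).fieldRange
  have hφk : ∀ c : k, algebraMap k Ω c = algebraMap F Ω (algebraMap k F c) := fun c =>
    IsScalarTower.algebraMap_apply k F Ω c
  have hkF : kh ≤ Fh := by
    rintro _ ⟨c, rfl⟩
    exact ⟨algebraMap k F c, (hφk c).symm⟩
  have hφV : ∀ x : F, algebraMap F Ω x ∈ V ↔ x ∈ O := fun x => by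
    rw [← ValuationSubring.mem_comap, hVO]
  have hkV : (kh : Set Ω) ⊆ V := by
    rintro _ ⟨c, rfl⟩
    change algebraMap k Ω c ∈ V
    rw [hφk, hφV]
    exact hkO c
  -- `F̂ | k̂` is finitely generated
  obtain ⟨t, ht⟩ := hfgtop
  have hfg : FGOver kh Fh := by
    refine ⟨t.image (algebraMap F Ω), ?_⟩
    have h2 : (IntermediateField.adjoin k ((algebraMap F Ω) '' (t : Set F))).toSubfield = Fh := by
      rw [← IsScalarTower.coe_toAlgHom' k F Ω, ← IntermediateField.adjoin_map, ht,
        ← AlgHom.fieldRange_eq_map, AlgHom.fieldRange_toSubfield]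
      rfl
    rw [Finset.coe_image, ← h2, IntermediateField.adjoin_toSubfield]
    rfl
  -- the finite set `Ẑ ⊆ V ∩ F̂`
  let Zh : Finset Ω := Z.image (algebraMap F Ω)
  have hZh : ∀ z ∈ Zh, z ∈ V ∧ z ∈ Fh := by
    intro z hz
    obtain ⟨z₀, hz₀, rfl⟩ := Finset.mem_image.mp hz
    exact ⟨(hφV z₀).mpr (hZO z₀ hz₀), ⟨z₀, rfl⟩⟩
  obtain ⟨𝒦, 𝓕, hk𝒦, hF𝓕, h𝒦𝓕, hfpi, hsep, hSU⟩ := knafKuhlmann2009_thm12_ambient h11 h23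
    h342 h05 h22 V kh Fh hkF hfg hkV Zh hZh
  have hsepall : ∀ x ∈ 𝓕, IsSeparable ↥(Fh ⊔ 𝒦) x := fun x hx => hsep.isSeparable hx
  obtain ⟨s₂, hs₂, h𝒦cl⟩ := hfpi
  obtain ⟨s₁, hs₁, h𝓕cl⟩ := hsep
  -- exponential characteristics
  haveI := expChar_of_injective_ringHom (algebraMap k Ω).injective (ringExpChar k)
  have hqq : ringExpChar Ω = ringExpChar k := ringExpChar.eq Ω (ringExpChar k)
  -- the intermediate field `L := 𝓕`
  let L : IntermediateField F Ω := 𝓕.toIntermediateField fun c => hF𝓕 ⟨c, rfl⟩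
  have hL : ∀ x : Ω, x ∈ L ↔ x ∈ 𝓕 := fun x => Iff.rfl
  have hLinj : Function.Injective (algebraMap L Ω) := Subtype.val_injective
  -- algebraicity of the generators over `F`
  have hs₂kh : ∀ x ∈ s₂, ∃ (n : ℕ) (c : k), x ^ (ringExpChar k) ^ n = algebraMap k Ω c := by
    intro x hx
    obtain ⟨n, hn⟩ := hs₂ x hx
    rw [hqq] at hn
    obtain ⟨c, hc⟩ := hn
    exact ⟨n, c, hc.symm⟩
  have hs₂int : ∀ x ∈ s₂, IsIntegral F x := by
    intro x hx
    obtain ⟨n, c, hc⟩ := hs₂kh x hx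
    have hq0 : (ringExpChar k) ^ n ≠ 0 := pow_ne_zero n (expChar_pos k (ringExpChar k)).ne'
    refine ⟨Polynomial.X ^ (ringExpChar k) ^ n - Polynomial.C (algebraMap k F c),
      Polynomial.monic_X_pow_sub_C _ hq0, ?_⟩
    simp [hc, hφk]
  have h𝒦alg : ∀ w ∈ 𝒦, IsAlgebraic Fh w := by
    intro w hw
    rw [← h𝒦cl] at hw
    refine isAlgebraic_of_subfield_le hkF (isAlgebraic_of_mem_closure (fun x hx => ?_) hw)
    obtain ⟨n, c, hc⟩ := hs₂kh x hx
    have hq0 : (ringExpChar k) ^ n ≠ 0 := pow_ne_zero n (expChar_pos k (ringExpChar k)).ne'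
    refine IsIntegral.isAlgebraic ⟨Polynomial.X ^ (ringExpChar k) ^ n - Polynomial.C ⟨_, c, rfl⟩,
      Polynomial.monic_X_pow_sub_C _ hq0, ?_⟩
    simp [hc]
    exact sub_self _
  have hFh𝒦 : Subfield.closure ((Fh : Set Ω) ∪ s₂) = Fh ⊔ 𝒦 := by
    rw [← h𝒦cl, closure_union_eq_sup, closure_union_eq_sup, ← sup_assoc, sup_eq_left.mpr hkF]
  have hFh𝒦alg : ∀ w ∈ Fh ⊔ 𝒦, IsAlgebraic Fh w := by
    intro w hw
    rw [← hFh𝒦] at hw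
    exact isAlgebraic_of_mem_closure (fun x hx => h𝒦alg x
      (h𝒦cl ▸ Subfield.subset_closure (Or.inr hx))) hw
  let eF : F ≃+* Fh := (algebraMap F Ω).rangeRestrictFieldEquiv
  have heF : (algebraMap F Ω).comp eF.symm.toRingHom = algebraMap Fh Ω := by
    ext y
    exact (algebraMap F Ω).rangeRestrictFieldEquiv_apply_symm_apply y
  have hs₁int : ∀ x ∈ s₁, IsIntegral F x := by
    intro x hx
    have h1 : IsAlgebraic ↥(Fh ⊔ 𝒦) x := (hs₁ x hx).isIntegral.isAlgebraic
    have h2 : IsAlgebraic Fh x := isAlgebraic_trans_subfield le_sup_left hFh𝒦alg h1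
    exact (isAlgebraic_of_ringHom_comp_eq eF.symm.toRingHom heF h2).isIntegral
  -- `L = F(s₂, s₁)` is finite over `F`
  have hLadj : L = IntermediateField.adjoin F ((s₂ : Set Ω) ∪ s₁) := by
    apply IntermediateField.toSubfield_injective
    rw [IntermediateField.adjoin_toSubfield]
    change 𝓕 = Subfield.closure ((Fh : Set Ω) ∪ ((s₂ : Set Ω) ∪ (s₁ : Set Ω)))
    rw [← h𝓕cl, ← hFh𝒦]
    simp only [Subfield.closure_union, Subfield.closure_eq, sup_assoc]
  have hfinL : FiniteDimensional F L := by
    haveI : Finite (↥((s₂ : Set Ω) ∪ s₁)) :=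
      (Set.finite_union.mpr ⟨s₂.finite_toSet, s₁.finite_toSet⟩).to_subtype
    have : FiniteDimensional F (IntermediateField.adjoin F ((s₂ : Set Ω) ∪ s₁)) :=
      IntermediateField.finiteDimensional_adjoin fun x hx => by
        rcases hx with hx | hx
        · exact hs₂int x hx
        · exact hs₁int x hx
    rw [hLadj]
    exact this
  -- the intermediate field `k' := k(T)`, `T` the lift of `s₂` to `L`; it is `𝒦`
  have h𝒦L : ∀ x ∈ 𝒦, x ∈ L := fun x hx => h𝒦𝓕 hx
  let T : Set L := {y : L | (y : Ω) ∈ s₂}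
  have hTfin : T.Finite := s₂.finite_toSet.preimage Subtype.val_injective.injOn
  let k' : IntermediateField k L := IntermediateField.adjoin k T
  let f : L →ₐ[k] Ω := (IntermediateField.val L).restrictScalars k
  have hfT : f '' T = (s₂ : Set Ω) := by
    ext x
    constructor
    · rintro ⟨y, hy, rfl⟩
      exact hy
    · intro hx
      exact ⟨⟨x, h𝒦L x (h𝒦cl ▸ Subfield.subset_closure (Or.inr hx))⟩, hx, rfl⟩
  have hk'map : (k'.map f).toSubfield = 𝒦 := by
    change ((IntermediateField.adjoin k T).map f).toSubfield = 𝒦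
    rw [IntermediateField.adjoin_map, hfT, IntermediateField.adjoin_toSubfield, ← h𝒦cl]
    rfl
  have hk' : ∀ y : L, y ∈ k' ↔ (y : Ω) ∈ 𝒦 := by
    intro y
    rw [← hk'map, IntermediateField.mem_toSubfield, IntermediateField.mem_map]
    constructor
    · exact fun hy => ⟨y, hy, rfl⟩
    · rintro ⟨x, hx, hxy⟩
      have : x = y := Subtype.ext hxy
      exact this ▸ hx
  have hTpow : ∀ y ∈ T, ∃ n : ℕ, y ^ (ringExpChar k) ^ n ∈ (algebraMap k L).range := by
    intro y hy
    obtain ⟨n, c, hc⟩ := hs₂kh y hy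
    refine ⟨n, c, hLinj ?_⟩
    rw [map_pow]
    exact hc.symm
  have hfink' : FiniteDimensional k k' := by
    haveI : Finite T := hTfin.to_subtype
    refine IntermediateField.finiteDimensional_adjoin fun y hy => ?_
    obtain ⟨n, c, hc⟩ := hTpow y hy
    have hq0 : (ringExpChar k) ^ n ≠ 0 := pow_ne_zero n (expChar_pos k (ringExpChar k)).ne'
    refine ⟨Polynomial.X ^ (ringExpChar k) ^ n - Polynomial.C c, Polynomial.monic_X_pow_sub_C _ hq0, ?_⟩
    simp [← hc]
  have hpi : IsPurelyInseparable k k' :=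
    (IntermediateField.isPurelyInseparable_adjoin_iff_pow_mem k L (ringExpChar k)).mpr hTpow
  -- the model, transported to `L`
  obtain ⟨C, hCV, hC𝓕, hfpC, hfracC, hsmC, hZC⟩ := hSU
  let O' : ValuationSubring L := V.comap (algebraMap L Ω)
  let A : Subalgebra k' L :=
    { carrier := {y : L | (y : Ω) ∈ C}
      mul_mem' := fun {a b} (ha : (a : Ω) ∈ C) (hb : (b : Ω) ∈ C) =>
        show ((a * b : L) : Ω) ∈ C from mul_mem ha hb
      one_mem' := show ((1 : L) : Ω) ∈ C from one_mem C
      add_mem' := fun {a b} (ha : (a : Ω) ∈ C) (hb : (b : Ω) ∈ C) =>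
        show ((a + b : L) : Ω) ∈ C from add_mem ha hb
      zero_mem' := show ((0 : L) : Ω) ∈ C from zero_mem C
      algebraMap_mem' := fun c =>
        show ((algebraMap k' L c : L) : Ω) ∈ C from C.algebraMap_mem ⟨((c : L) : Ω), (hk' c).mp c.2⟩ }
  have hA : ∀ y : L, y ∈ A ↔ (y : Ω) ∈ C := fun y => Iff.rfl
  have hAO' : A.toSubring ≤ O'.toSubring := fun y hy => ValuationSubring.mem_comap.mpr (hCV hy)
  let eR : k' ≃+* 𝒦 :=
    { toFun := fun c => ⟨((c : L) : Ω), (hk' c).mp c.2⟩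
      invFun := fun y => ⟨⟨y, h𝒦L y y.2⟩, (hk' _).mpr y.2⟩
      left_inv := fun c => Subtype.ext (Subtype.ext rfl)
      right_inv := fun y => Subtype.ext rfl
      map_mul' := fun _ _ => rfl
      map_add' := fun _ _ => rfl }
  let eA : A ≃+* C :=
    { toFun := fun y => ⟨((y : L) : Ω), y.2⟩
      invFun := fun x => ⟨⟨x, hC𝓕 x.2⟩, x.2⟩
      left_inv := fun y => Subtype.ext (Subtype.ext rfl)
      right_inv := fun x => Subtype.ext rfl
      map_mul' := fun _ _ => rfl
      map_add' := fun _ _ => rfl }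
  have hcompat : ∀ r : 𝒦, eA.symm (algebraMap 𝒦 C r) = algebraMap k' A (eR.symm r) :=
    fun r => Subtype.ext (Subtype.ext rfl)
  haveI := hfpC
  have hfpA : Algebra.FinitePresentation k' A :=
    finitePresentation_of_ringEquiv_pair eR.symm eA.symm hcompat
  have hsmA : Algebra.IsSmoothAt k' (centre A O' hAO') := by
    refine formallySmooth_localization_of_ringEquiv_pair eR.symm eA.symm hcompat
      (centre C V hCV) (centre A O' hAO') (fun x => ?_) hsmC
    rw [mem_centre_iff, mem_centre_iff]
    exact (comap_valuation_lt_one_iff V (algebraMap L Ω) ((eA.symm x : A) : L)).symm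
  have hfracA : IsFractionRing A L := by
    refine IsFractionRing.of_field A L fun x => ?_
    obtain ⟨a, ha, b, hb, hab⟩ := hfracC (x : Ω) x.2
    refine ⟨⟨⟨a, hC𝓕 ha⟩, ha⟩, ⟨⟨b, hC𝓕 hb⟩, hb⟩, hLinj ?_⟩
    rw [map_div₀]
    exact hab
  refine ⟨L, k', hfinL, hfink', hpi, ?_, A, hAO', hfpA, hfracA, hsmA, ?_⟩
  · -- separability of `L` over `F(k') = F̂.𝒦`
    intro x
    let E : IntermediateField F L := IntermediateField.adjoin F (k' : Set L)
    have hEmap : (E.map (IntermediateField.val L)).toSubfield = Fh ⊔ 𝒦 := by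
      have himg : (IntermediateField.val L) '' (k' : Set L) = (𝒦 : Set Ω) := by
        ext w
        constructor
        · rintro ⟨y, hy, rfl⟩
          exact (hk' y).mp hy
        · intro hw
          exact ⟨⟨w, h𝒦L w hw⟩, (hk' _).mpr hw, rfl⟩
      change ((IntermediateField.adjoin F (k' : Set L)).map (IntermediateField.val L)).toSubfield
        = Fh ⊔ 𝒦
      rw [IntermediateField.adjoin_map, himg, IntermediateField.adjoin_toSubfield]
      change Subfield.closure ((Fh : Set Ω) ∪ (𝒦 : Set Ω)) = Fh ⊔ 𝒦
      rw [Subfield.closure_union, Subfield.closure_eq, Subfield.closure_eq]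
    have hE : ∀ y : L, y ∈ E ↔ (y : Ω) ∈ Fh ⊔ 𝒦 := by
      intro y
      rw [← hEmap, IntermediateField.mem_toSubfield, IntermediateField.mem_map]
      constructor
      · exact fun hy => ⟨y, hy, rfl⟩
      · rintro ⟨x, hx, hxy⟩
        have : x = y := Subtype.ext hxy
        exact this ▸ hx
    have hEL : ∀ w ∈ Fh ⊔ 𝒦, w ∈ L := fun w hw =>
      (sup_le hF𝓕 h𝒦𝓕 : Fh ⊔ 𝒦 ≤ 𝓕) hw
    let g : ↥(Fh ⊔ 𝒦) →+* E :=
      { toFun := fun w => ⟨⟨w, hEL w w.2⟩, (hE _).mpr w.2⟩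
        map_one' := rfl
        map_mul' := fun _ _ => rfl
        map_zero' := rfl
        map_add' := fun _ _ => rfl }
    have h1 : IsSeparable E (algebraMap L Ω x) :=
      isSeparable_of_ringHom_comp_eq g (RingHom.ext fun _ => rfl) (hsepall (x : Ω) x.2)
    change (minpoly E x).Separable
    rw [← minpoly.algebraMap_eq (A := E) hLinj x]
    exact h1
  · -- `Z ⊆ A_q`
    rintro _ ⟨z₀, hz₀, rfl⟩
    have hz : algebraMap F Ω z₀ ∈ Zh := Finset.mem_image_of_mem _ (Finset.mem_coe.mp hz₀)
    obtain ⟨a, ha, b, hb, hvb, hab⟩ := hZC _ hz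
    have hbO' : (⟨b, hC𝓕 hb⟩ : L) ∈ O' := ValuationSubring.mem_comap.mpr (hCV hb)
    refine ⟨⟨a, hC𝓕 ha⟩, ha, ⟨b, hC𝓕 hb⟩, hb, ?_, hLinj ?_⟩
    · exact (comap_valuation_eq_one_iff V (algebraMap L Ω) hbO').mpr hvb
    · rw [map_div₀]
      exact hab

/-- **The printed Thm. 1.2 implies the weak (regular-centre) form** `KnafKuhlmann2009`,
without the named fact EGA IV 17.5.8: as `KnafKuhlmann2009.of_thm12`
(`SmoothUniformization.lean`), with "smooth over a field ⇒ regular" supplied by the theorem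
`isRegularLocalRing_of_isSmoothAt` (`SmoothImpliesRegular.lean`). [folklore] -/
theorem KnafKuhlmann2009.of_thm12' (h12 : KnafKuhlmann2009_Thm12.{u}) :
    KnafKuhlmann2009.{u} := by
  intro k K _ _ _ hfg O hO
  obtain ⟨P, hP⟩ := exists_valuationSubring_comap_eq (Ω := AlgebraicClosure K) O
  obtain ⟨L, k', hfinL, hfink', -, -, A, hA, hfp, hfrac, hsm, -⟩ :=
    h12 k K hfg O hO ∅ (by simp) (AlgebraicClosure K) P hP
  refine ⟨L, inferInstance, inferInstance, inferInstance, inferInstance, hfinL,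
    P.comap (algebraMap L (AlgebraicClosure K)), ?_, ?_⟩
  · rw [ValuationSubring.comap_comap, ← IsScalarTower.algebraMap_eq]
    exact hP
  · haveI := hfp
    haveI : Algebra.FiniteType k' A := inferInstance
    haveI : Algebra.FiniteType k k' := inferInstance
    have hft : Algebra.FiniteType k A := Algebra.FiniteType.trans ‹_› ‹Algebra.FiniteType k' A›
    refine ⟨A.restrictScalars k, hA, ?_, hfrac, ?_⟩
    · exact (Subalgebra.fg_iff_finiteType _).mpr hft
    · haveI : Algebra.IsSmoothAt k' (centre A _ hA) := hsm
      exact isRegularLocalRing_of_isSmoothAt k' A (centre A _ hA)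

/-- **The named fact `KnafKuhlmann2009` from its ingredients**: Knaf–Kuhlmann 2009, Thm. 1.2
in the weak, regular-centre form of `LocalUniformization.lean` follows from the three
Knaf–Kuhlmann facts KK09 Thm. 1.1, KK09 Prop. 2.3 and KK05 Thm. 1.1 of
`FiniteExtensionUniformization.lean` (everything else — KK09 Prop. 3.2, Prop. 3.4 (2), KK05
Thm. 2.1, Cor. 2.2, smooth ⇒ regular — being proved). [cite: KnafKuhlmann2009, Thm. 1.2] -/
theorem KnafKuhlmann2009.of_parts (h11 : KnafKuhlmann2009_Thm11.{u})
    (h23 : KnafKuhlmann2009_Prop23.{u}) (h05 : KnafKuhlmann2005_Thm11.{u}) :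
    KnafKuhlmann2009.{u} :=
  KnafKuhlmann2009.of_thm12' (KnafKuhlmann2009_Thm12.of_parts h11 h23 h05)

end Literature.AlgebraicGeometry.Resolution

end
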